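import Summits.QuantumFields.QCD.Theorems.HeatSlicedQuarksQuarkLoopCoefficientSecondOrderExpansionAuxO
import Summits.QuantumFields.QCD.Theorems.HeatSlicedQuarksQuarkLoopCoefficientTwistedDuhamel

/-!
# Second-order expansion of the symmetric-gauge heat symbol in the flux (stub `stub_secondOrderExpansion`)
(line `Sketch` of crux stmt-QuantumFields-16786 `QuarkLoopCoefficient`)

The spin trace of `E_θ(t)(0) − E_0(t)(0)` (`E_θ = symHeat θ`) has a cubic Taylor polynomial in the flux
`θ` with Landau remainder `C θ⁴ t²` on `1 ≤ t`, `|θ| t ≤ c₀`, whose `θ²`-coefficient is the explicit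
`e2 t` of the Defs file.  Proof: the assembly `secondOrderExpansion_of_twistedDuhamel` of the helper files
`…SecondOrderExpansionAux*` (second-order remainder `R₂ = E_θ − E₀ − θE₁` with the full propagator,
cocycle Taylor bounds, Gaussian profile calculus) fed with the twisted Duhamel principle
`stub_twistedDuhamel` of `…TwistedDuhamel`.
-/

noncomputable section

namespace Summit.QuantumFields.QCD.Cruxes.QuarkLoopCoefficient.Sketch

open Literature.MathematicalPhysics.QuantumLattice Literature.MathematicalPhysics.QuantumFieldTheory
open Literature.Probability.LatticeModels (Site TorusSite)
open Summit.QuantumFields.QCD.Theorems.QuarkLoopCoefficient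
open scoped Matrix ComplexConjugate

/-- **Second-order expansion of the heat symbol** (registered stub `stub_secondOrderExpansion` of crux
stmt-QuantumFields-16786, line `Sketch`): from the free majorant toolkit, the free heat calculus and the
Gaussian majorant of the symmetric-gauge heat symbol, the spin-traced heat symbol at the origin satisfies
`‖tr[E_θ(t)(0) − E_0(t)(0)] − (θ a₁ t + θ² e2 t + θ³ a₃ t)‖ ≤ C θ⁴ t²` for `1 ≤ t`, `|θ| t ≤ c₀`. -/
theorem stub_secondOrderExpansion :
    ((∃ C c : ℝ, 0 < c ∧ ∀ t : ℝ, 0 ≤ t → ∀ w : Site 4, |freeKer t w| ≤ C * gaussProfile c t w) ∧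
      (∀ c ε : ℝ, 0 < c → 0 < ε → ε < 1 → ∃ B : ℝ, ∀ a b : ℝ, 0 ≤ a → 0 ≤ b → ∀ w : Site 4,
        Summable (fun y : Site 4 => gaussProfile ((1 - ε) * c) a y * gaussProfile c b (w - y)) ∧
        ∑' y : Site 4, gaussProfile ((1 - ε) * c) a y * gaussProfile c b (w - y) ≤
          B * gaussProfile ((1 - ε) * c) (a + b) w) ∧
      (∀ c ε : ℝ, 0 < c → 0 < ε → ε < 1 → ∀ j : ℕ, ∃ A : ℝ, ∀ t : ℝ, 0 ≤ t → ∀ w : Site 4,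
        elen w ^ j * gaussProfile c t w ≤ A * Real.sqrt (1 + t) ^ j * gaussProfile ((1 - ε) * c) t w) ∧
      (∀ c ε : ℝ, 0 < c → 0 < ε → ε < 1 → ∃ A : ℝ, ∀ t : ℝ, 0 ≤ t → ∀ w z : Site 4, elen z ≤ 2 →
        gaussProfile c t (w + z) ≤ A * gaussProfile ((1 - ε) * c) t w) ∧
      (∀ c : ℝ, 0 < c → ∃ A : ℝ, ∀ t : ℝ, 0 ≤ t →
        Summable (fun y : Site 4 => gaussProfile c t y) ∧ ∑' y : Site 4, gaussProfile c t y ≤ A) ∧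
      (∀ c : ℝ, 0 < c → ∃ C : ℝ, ∀ (L : ℕ), 1 ≤ L → ∀ t : ℝ, 1 ≤ t → t ≤ (L : ℝ) ^ 2 →
        Summable (fun n : Site 4 => gaussProfile c t (fun μ => (L : ℤ) * n μ)) ∧
        ∑' n : Site 4, (if n = 0 then 0 else gaussProfile c t (fun μ => (L : ℤ) * n μ)) ≤
          C * Real.exp (-(c / 2 * (L : ℝ) ^ 2 / (t + (L : ℝ)))) / t ^ 2)) →
    ((∀ x y : Site 4, sqKer (fun _ => (1 : ℂ)) x y = ((hhat (y - x) : ℝ) : ℂ) • (1 : Spin)) ∧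
      (∀ t : ℝ, 0 ≤ t → ∀ x y : Site 4,
        heatKer (fun _ => (1 : ℂ)) t x y = ((freeKer t (y - x) : ℝ) : ℂ) • (1 : Spin)) ∧
      (∀ w : Site 4, freeKer 0 w = if w = 0 then 1 else 0) ∧
      (∀ (t : ℝ) (w : Site 4),
        HasDerivAt (fun s => freeKer s w) (-(∑ z ∈ nbr2 0, hhat z * freeKer t (w - z))) t) ∧
      (∀ s r : ℝ, 0 ≤ s → 0 ≤ r → ∀ w : Site 4,
        HasSum (fun y : Site 4 => freeKer s y * freeKer r (w - y)) (freeKer (s + r) w)) ∧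
      (∀ t : ℝ, 0 ≤ t → ∀ (w : Site 4) (ν : Fin 4),
        t * (∑ z ∈ nbr2 0, ((z ν : ℤ) : ℝ) * hhat z * freeKer t (w - z)) + ((w ν : ℤ) : ℝ) * freeKer t w = 0) ∧
      (∀ (t : ℝ) (w : Site 4), freeKer t (-w) = freeKer t w)) →
    (∃ c₀ : ℝ, 0 < c₀ ∧ ∃ C c : ℝ, 0 < c ∧ ∀ θ t : ℝ, 0 ≤ t → |θ| ≤ c₀ → |θ| * t ≤ c₀ →
        ∀ (w : Site 4) (α β : Fin 4), ‖symHeat θ t w α β‖ ≤ C * gaussProfile c t w) →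
    (∃ c₀ : ℝ, 0 < c₀ ∧ ∃ C : ℝ, ∃ a₁ a₃ : ℝ → ℂ, ∀ θ t : ℝ, 1 ≤ t → |θ| * t ≤ c₀ →
        ‖(∑ α : Fin 4, (symHeat θ t 0 α α - symHeat 0 t 0 α α)) -
            ((θ : ℂ) * a₁ t + (θ : ℂ) ^ 2 * e2 t + (θ : ℂ) ^ 3 * a₃ t)‖ ≤ C * θ ^ 4 * t ^ 2) :=
  SecondOrderExpansion.secondOrderExpansion_of_twistedDuhamel stub_twistedDuhamel

end Summit.QuantumFields.QCD.Cruxes.QuarkLoopCoefficient.Sketch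

end
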